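import Literature.NumberTheory.Rogawski1990.ArchTransfFamilyJumpUnitJets    -- PART 3c (LH7-p02 (g2)): the linear phase, prefactor jets; brings PART 3a Jets (letters), ★ Resolved, ★ B1 WallGeometry, ★ BoundedJetsLeibnizReflection
import Literature.NumberTheory.Rogawski1990.ArchTransfFamilyJumpZero        -- PART 2c: `transfFam_eq_resolvedSum_of_tame`
import Literature.Analysis.Calculus.IteratedFDerivLeibniz                   -- ★ p850350 (F0P3a-p09 (g5)) (LEIBNIZ-JET): `iteratedFDeriv_mul_apply_eq_sum_powerset`
import HarnessLib

/-!
# (I₃) for the candidate transfer family — PART 3d (LOCAL FORMS): `archERho_S · transfFam S` near a tame point is `Σ_ρ κ_ρ · W_S · ('F_S ∘ ρ)`, its jets by Leibniz;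
# the `x`-parity killer on the Cayley side; counting normal letters through sub-words (Shelstad 1979 §4; Bouaziz 1994 §3.2; Rogawski 1990 §4.3)

Topic `NumberTheory/Rogawski1990`; namespace `Literature.NumberTheory.Rogawski1990`.  THEOREMS ONLY (no `def`, no instance, no notation, no axiom, no named fact, no `sorry`).
Cell `pub/hodgecm-mathlib`, line LH3 (closer stub `stub_N9`, crux H413 = `stmt-HodgeConjecture-24833`), organ **O-L2 (I₃-TRANSF)**, ED. 3 brick (W3, first half) of the (P) half
(LH3-plan (g3) 2026-09-02T07:53Z; author LH7-p02 (g2)).  HONEST LABEL: HC_CM is proved only modulo the 7 printed citations (2 remaining: hLiu418 = `stmt-HodgeConjecture-24832`,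
h413 = `stmt-HodgeConjecture-24833`) until rung 0 closes; count-neutral.

THE MATHEMATICS.  §1 small geometry: `slotPerm ρ′` commutes with the sign change `negXAt w₀` when `ρ′ w₀ = 1`; `negXAt` fixes the Cayley point and acts on the Cayley letters by the
eigen-signs `−1` on `∂_x`, `+1` elsewhere (★ B1); counting the normal letters of a sub-word `m ∘ t.orderEmbOfFin`.  §2 THE PARITY KILLER: on the split chart `S″ ∋ w₀`, the twisted
family `'F_{S″} ∘ slotPerm ρ′` (`ρ′ w₀ = 1`) is EVEN in `x_{w₀}` ((W).2 of ★ `ArchHcWeyl` + ★ `archERhoG_negXAt_of_mem`), so at a point with `x_{w₀} = 0` every jet on a Cayley word with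
an ODD number of `∂_x` letters vanishes (★ `iteratedFDeriv_apply_eq_zero_of_comp_eq_self`).  §3 LOCAL FORM: near every TAME point `x` of `InRegS S` (all partner points in
★ `InRegG`) the twisted transfer family is the finite sum `archERho S c · transfFam S c = Σ_{ρ ∈ partnerPerms S} κ_ρ · W_S(c) · 'F_S(ρ·c)` with the ENTIRE prefactor
`W_S = w_S · archERho_S · Ũ_k` (PART 2c `transfFam_eq_resolvedSum_of_tame` on the open tame set), hence (★ `Filter.EventuallyEq.iteratedFDeriv`, ★ LEIBNIZ-JET) its `n`-jet on a
word `d` is `Σ_ρ κ_ρ Σ_{s ⊆ Fin n} D^{|s|}W_S(x)(d_s) · D^{|sᶜ|}('F_S∘ρ)(x)(d_{sᶜ})` (`iteratedFDeriv_archERho_mul_transfFam_apply_of_tame`) — used at the `G`-regular points of the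
normal curve AND at the Cayley point (both tame).

## References
* [Shelstad1979] D. Shelstad, *Characters and inner forms of a quasi-split group over ℝ*, Compositio Math. 39 (1979), §4 (II) p. 23, Lemma 4.3 p. 25, Thm. 4.7 (IIIb) p. 31.
* [Bouaziz1994IntegralesOrbitales] A. Bouaziz, *Intégrales orbitales sur les groupes de Lie réductifs*, Ann. Sci. ÉNS 27 (1994), §3.2 (I₁)–(I₃) pp. 579–580, Rem. 2 p. 594.
* [Rogawski1990] J. D. Rogawski, *Automorphic Representations of Unitary Groups in Three Variables* (1990), §4.3 (4.3.1) p. 43, §4.9 p. 55.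
-/

set_option autoImplicit false

noncomputable section

open NumberField NumberField.InfinitePlace Complex Set Filter Topology Equiv Finset
open scoped Classical Real ContDiff
open Literature.NumberTheory.Automorphic Literature.NumberTheory.Automorphic.UnitaryGroup Literature.NumberTheory.Automorphic.ArchCartan
open Literature.NumberTheory.Automorphic.Shelstad1979.StableOrbitalIntegrals
open Literature.NumberTheory.GaloisRepresentations
open Literature.Analysis.Calculus

namespace Literature.NumberTheory.Rogawski1990

/-! ## §1 Small geometry: `negXAt` versus `slotPerm`, the Cayley point, the Cayley letters; counting normal letters in sub-words -/

section Geometry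

variable {W : Type*} [DecidableEq W]

/-- A `w₀`-trivial relabelling commutes with the sign change at `w₀`. [cite: Shelstad1979, §4 (II) p. 23] -/
theorem slotPerm_negXAt_of_apply_eq_one {ρ' : W → Perm (Fin 3)} {w₀ : W} (h : ρ' w₀ = 1) (c : W → Fin 3 → ℝ) :
    slotPerm ρ' (negXAt w₀ c) = negXAt w₀ (slotPerm ρ' c) := by
  funext v j
  by_cases hv : v = w₀
  · subst hv
    rw [slotPerm_apply, h, Equiv.Perm.coe_one, id_eq, negXAt_apply_self, negXAt_apply_self, slotPerm_apply_of_eq_one h]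
  · rw [slotPerm_apply, negXAt_apply_of_ne hv, negXAt_apply_of_ne hv, slotPerm_apply]

/-- The sign change fixes every point of the real wall `x_{w₀} = 0`. [cite: Shelstad1979, §4 p. 25] -/
theorem negXAt_eq_self_of_apply_zero {w₀ : W} {q : W → Fin 3 → ℝ} (hq : q w₀ 0 = 0) : negXAt w₀ q = q := by
  funext v j
  by_cases hv : v = w₀
  · subst hv
    rw [negXAt_apply_self]
    fin_cases j
    · simp [hq]
    · simp
    · simp
  · rw [negXAt_apply_of_ne hv]

/-- The sign change on the Cayley letters: `−1` on `∂_x = bzCayVec (w₀, 0)`, `+1` on every other letter (★ B1 `negXAt_hcCayVec`). [cite: Shelstad1979, §4 (II) p. 23] -/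
theorem negXAt_bzCayVec (w₀ : W) (l : W × Fin 3) : negXAt w₀ (bzCayVec l) = (if l = (w₀, 0) then (-1 : ℝ) else 1) • bzCayVec l := by
  have h := negXAt_hcCayVec w₀ 0 2 l
  rw [← bzCayVec_eq_hcCayVec w₀] at h
  exact h

omit [DecidableEq W] in
/-- Counting letters of a sub-word read along `t.orderEmbOfFin`: `#{r | m (t_r) = x} = #(t ∩ {i | m i = x})`. [cite: Shelstad1979, Lemma 4.3 (p. 25)] -/
theorem card_filter_comp_orderEmbOfFin {n : ℕ} (t : Finset (Fin n)) {X : Type*} (m : Fin n → X) (x : X) :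
    (Finset.univ.filter fun r : Fin t.card => m (t.orderEmbOfFin rfl r) = x).card = (t.filter fun i => m i = x).card := by
  have h : (Finset.univ.filter fun r : Fin t.card => m (t.orderEmbOfFin rfl r) = x).map (t.orderEmbOfFin rfl).toEmbedding = t.filter fun i => m i = x := by
    have h2 := Finset.filter_map (s := (Finset.univ : Finset (Fin t.card))) (f := (t.orderEmbOfFin rfl).toEmbedding) (p := fun i => m i = x)
    rw [Finset.map_orderEmbOfFin_univ] at h2
    rw [h2]
    rfl
  rw [← h, Finset.card_map]

omit [DecidableEq W] in
/-- If no letter indexed by `s` is `x`, the letters `x` of `m` are exactly those of the complementary sub-word. [cite: Shelstad1979, Lemma 4.3 (p. 25)] -/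
theorem card_filter_compl_orderEmbOfFin_eq {n : ℕ} (s : Finset (Fin n)) {X : Type*} (m : Fin n → X) (x : X) (hs : ∀ i ∈ s, m i ≠ x) :
    (Finset.univ.filter fun r : Fin sᶜ.card => m (sᶜ.orderEmbOfFin rfl r) = x).card = (Finset.univ.filter fun i => m i = x).card := by
  rw [card_filter_comp_orderEmbOfFin]
  congr 1
  ext i
  simp only [Finset.mem_filter, Finset.mem_compl, Finset.mem_univ, true_and]
  exact ⟨fun h => h.2, fun h => ⟨fun hi => hs i hi h, h⟩⟩

omit [DecidableEq W] in
/-- If some letter indexed by `s` is `x`, the sub-word along `s` contains it. [cite: Shelstad1979, Lemma 4.3 (p. 25)] -/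
theorem exists_orderEmbOfFin_eq {n : ℕ} (s : Finset (Fin n)) {X : Type*} (m : Fin n → X) (x : X) {i : Fin n} (hi : i ∈ s) (hmi : m i = x) :
    ∃ r : Fin s.card, m (s.orderEmbOfFin rfl r) = x := by
  have hrange : i ∈ Set.range (s.orderEmbOfFin rfl) := by rw [Finset.range_orderEmbOfFin]; exact hi
  obtain ⟨r, hr⟩ := hrange
  exact ⟨r, by rw [hr, hmi]⟩

end Geometry

/-! ## §2 The parity killer on the split chart -/

section Parity

variable (L : Type) [Field L] [NumberField L] [IsCMField L] (α : Fin 3 → L)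

omit [IsCMField L] in
/-- `'F_{S′} ∘ slotPerm τ` is `C^∞` on the preimage of `T_{in-reg}` ((I₁) + the entire twist). [cite: Bouaziz1994IntegralesOrbitales, §3.2 (I₁) p. 579] -/
theorem contDiffOn_twisted_slotPerm {S : Finset {w : InfinitePlace L // IsComplex w}}
    {F : Finset {w : InfinitePlace L // IsComplex w} → ({w : InfinitePlace L // IsComplex w} → Fin 3 → ℝ) → ℂ} (hI1 : ContDiffOn ℝ ∞ (F S) (InRegG (slotSign L α) S))
    (τ : {w : InfinitePlace L // IsComplex w} → Perm (Fin 3)) :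
    ContDiffOn ℝ ∞ (fun c => archERhoG S (slotPerm τ c) * F S (slotPerm τ c)) (slotPerm τ ⁻¹' InRegG (slotSign L α) S) := by
  refine (contDiff_archERhoG_slotPerm S τ).contDiffOn.mul ?_
  obtain ⟨P, hP⟩ := exists_continuousLinearEquiv_eq_slotPerm τ
  have hcomp : (fun c : {w : InfinitePlace L // IsComplex w} → Fin 3 → ℝ => F S (slotPerm τ c)) = F S ∘ P := by funext c; rw [Function.comp_apply, hP]
  rw [hcomp]
  exact hI1.comp P.contDiff.contDiffOn fun c hc => by rw [hP]; exact hc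

omit [IsCMField L] in
/-- **THE PARITY KILLER**: on a split chart `S″ ∋ w₀`, under (W), for a `w₀`-trivial `ρ′` and a point `q` with `x_{w₀}(q) = 0`, the jet of `'F_{S″} ∘ slotPerm ρ′` at `q` on a Cayley word
with an ODD number of `∂_x` letters vanishes (`'F_{S″}` is even in `x_{w₀}`). [cite: Shelstad1979, Thm. 4.7 proof p. 31; §4 (II) p. 23] [cite: Bouaziz1994IntegralesOrbitales, §3.1 p. 579] -/
theorem iteratedFDeriv_twisted_cayley_eq_zero_of_odd {S'' : Finset {w : InfinitePlace L // IsComplex w}} {w₀ : {w : InfinitePlace L // IsComplex w}} (hw₀ : w₀ ∈ S'')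
    {F : Finset {w : InfinitePlace L // IsComplex w} → ({w : InfinitePlace L // IsComplex w} → Fin 3 → ℝ) → ℂ} (hW : ArchHcWeyl (slotSign L α) F)
    {ρ' : {w : InfinitePlace L // IsComplex w} → Perm (Fin 3)} (h1 : ρ' w₀ = 1) {q : {w : InfinitePlace L // IsComplex w} → Fin 3 → ℝ} (hq : q w₀ 0 = 0)
    {j : ℕ} {u : Fin j → {w : InfinitePlace L // IsComplex w} × Fin 3} (hodd : Odd (Finset.univ.filter fun r => u r = (w₀, 0)).card) :
    iteratedFDeriv ℝ j (fun c => archERhoG S'' (slotPerm ρ' c) * F S'' (slotPerm ρ' c)) q (fun i => (bzCayVec (u i) : {w : InfinitePlace L // IsComplex w} → Fin 3 → ℝ)) = 0 := by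
  obtain ⟨R, hR⟩ := exists_continuousLinearEquiv_negXAt w₀
  refine iteratedFDeriv_apply_eq_zero_of_comp_eq_self R ?_ ?_ j (ε := fun i => if u i = (w₀, 0) then (-1 : ℝ) else 1) (fun i => ?_) ?_
  · funext c
    rw [Function.comp_apply, hR, slotPerm_negXAt_of_apply_eq_one h1, archERhoG_negXAt_of_mem hw₀, hW.2 S'' (slotPerm ρ' c) w₀ hw₀]
  · rw [hR]; exact negXAt_eq_self_of_apply_zero hq
  · rw [hR]; exact negXAt_bzCayVec w₀ (u i)
  · rw [prod_eq_neg_one_pow_card (fun i => by by_cases h : u i = (w₀, 0) <;> simp [h])]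
    have hfilter : (Finset.univ.filter fun i => (if u i = (w₀, 0) then (-1 : ℝ) else 1) = -1) = Finset.univ.filter fun r => u r = (w₀, 0) := by
      ext r
      simp only [Finset.mem_filter, Finset.mem_univ, true_and]
      constructor
      · intro h
        by_contra hne
        rw [if_neg hne] at h
        norm_num at h
      · intro h
        rw [if_pos h]
    rw [hfilter]
    exact hodd.neg_one_pow

end Parity

/-! ## §3 The local form of `archERho_S · transfFam S` near a tame point and its Leibniz expansion -/

section Local

variable (L : Type) [Field L] [NumberField L] [IsCMField L] (α : Fin 3 → L) (μ : HeckeCharacter L)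

/-- **LOCAL FORM NEAR A TAME POINT**: for an admissible `S` and a point `x ∈ InRegS S` all of whose partner points lie in `T_{in-reg}(G′)`, on a neighbourhood of `x`
`archERho S c · transfFam S c = Σ_{ρ ∈ partnerPerms S} κ_ρ · (w_S · archERho S c · Ũ_k(c)) · 'F_S(ρ·c)` (PART 2c's tame identity on the open tame set). [cite: Rogawski1990, §4.3 (4.3.1) p. 43]
[cite: Bouaziz1994IntegralesOrbitales, §3.2 (I₁)–(I₂) p. 579; Rem. 2 p. 594] -/
theorem archERho_mul_transfFam_eventuallyEq_of_tame {S : Finset {w : InfinitePlace L // IsComplex w}} (hS : ∀ w ∈ S, w ∈ splitChartPlaces L α)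
    (F : Finset {w : InfinitePlace L // IsComplex w} → ({w : InfinitePlace L // IsComplex w} → Fin 3 → ℝ) → ℂ) (hI1 : ContDiffOn ℝ ∞ (F S) (InRegG (slotSign L α) S))
    (k : {w : InfinitePlace L // IsComplex w} → ℤ)
    (hk : ∀ c : {w : InfinitePlace L // IsComplex w} → Fin 3 → ℝ,
      archTau L (endoTorus L S c) μ * (archWeylRatio L (endoTorus L S c) : ℂ) =
        ∏ w : {w : InfinitePlace L // IsComplex w},
          -(((((if w ∈ S then boostEig (c w) else fun i => (Circle.exp (c w i) : ℂ)) 0) * ((if w ∈ S then boostEig (c w) else fun i => (Circle.exp (c w i) : ℂ)) 2)) ^ (k w)) *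
              ((((if w ∈ S then boostEig (c w) else fun i => (Circle.exp (c w i) : ℂ)) 1) - ((if w ∈ S then boostEig (c w) else fun i => (Circle.exp (c w i) : ℂ)) 0)) *
                (((if w ∈ S then boostEig (c w) else fun i => (Circle.exp (c w i) : ℂ)) 1) - ((if w ∈ S then boostEig (c w) else fun i => (Circle.exp (c w i) : ℂ)) 2))) /
            ((if w ∈ S then boostEig (c w) else fun i => (Circle.exp (c w i) : ℂ)) 1)))
    {x : {w : InfinitePlace L // IsComplex w} → Fin 3 → ℝ} (hx : x ∈ InRegS S) (htame : ∀ ρ ∈ partnerPerms S, slotPerm ρ x ∈ InRegG (slotSign L α) S) :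
    (fun c => archERho S c * transfFam L α μ F S c) =ᶠ[𝓝 x] fun c => ∑ ρ ∈ partnerPerms S,
      (((∏ w : {w : InfinitePlace L // IsComplex w},
          ((SignType.sign ((w.1.embedding (α (lineOf (formSign L α w) ((ρ w).symm 1)))).re) : ℤ) * archMajoritySign L (Matrix.diagonal α) w) : ℤ) : ℂ) *
        ∏ w : {w : InfinitePlace L // IsComplex w}, (Equiv.Perm.sign (ρ w) : ℂ)) *
      ((partnerWeight L α S * (archERho S c *
          ∏ w : {w : InfinitePlace L // IsComplex w}, (if w ∈ S then Complex.exp (((2 * k w + 1 : ℤ) : ℂ) * ((c w 2 : ℂ) * I))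
            else (((Circle.exp (c w 0) : ℂ) * Circle.exp (c w 2)) ^ (k w)) * (Circle.exp (c w 2) : ℂ)))) *
        (archERhoG S (slotPerm ρ c) * F S (slotPerm ρ c))) := by
  have hV : IsOpen {c : {w : InfinitePlace L // IsComplex w} → Fin 3 → ℝ | ∀ ρ ∈ partnerPerms S, slotPerm ρ c ∈ InRegG (slotSign L α) S} :=
    isOpen_setOf_forall_slotPerm_mem_inRegG (slotSign L α) S
  filter_upwards [(isOpen_inRegS S).mem_nhds hx, hV.mem_nhds htame] with c hc hct
  rw [transfFam_eq_resolvedSum_of_tame L α μ hS F hI1 k hk hc hct, Finset.mul_sum, Finset.mul_sum]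
  refine Finset.sum_congr rfl fun ρ _ => ?_
  ring

omit [IsCMField L] in
/-- **LEIBNIZ EXPANSION OF THE LOCAL FORM**: at a tame point `x` the `n`-jet of `archERho S · transfFam S` on a word `d` is
`Σ_ρ κ_ρ · Σ_{s ⊆ Fin n} D^{|s|}(w_S·archERho_S·Ũ_k)(x)(d_s) · D^{|sᶜ|}('F_S∘slotPerm ρ)(x)(d_{sᶜ})` — given the local form as an eventual equality.
[cite: Shelstad1979, Thm. 4.7 proof p. 31] [cite: Bouaziz1994IntegralesOrbitales, §3.2 p. 580] -/
theorem iteratedFDeriv_apply_eq_sum_of_eventuallyEq_resolved {S : Finset {w : InfinitePlace L // IsComplex w}}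
    {F : Finset {w : InfinitePlace L // IsComplex w} → ({w : InfinitePlace L // IsComplex w} → Fin 3 → ℝ) → ℂ} (hI1 : ContDiffOn ℝ ∞ (F S) (InRegG (slotSign L α) S))
    (k : {w : InfinitePlace L // IsComplex w} → ℤ) (K : ℂ) {Φ : ({w : InfinitePlace L // IsComplex w} → Fin 3 → ℝ) → ℂ} {x : {w : InfinitePlace L // IsComplex w} → Fin 3 → ℝ}
    (htame : ∀ ρ ∈ partnerPerms S, slotPerm ρ x ∈ InRegG (slotSign L α) S)
    (hΦ : Φ =ᶠ[𝓝 x] fun c => ∑ ρ ∈ partnerPerms S,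
      (((∏ w : {w : InfinitePlace L // IsComplex w},
          ((SignType.sign ((w.1.embedding (α (lineOf (formSign L α w) ((ρ w).symm 1)))).re) : ℤ) * archMajoritySign L (Matrix.diagonal α) w) : ℤ) : ℂ) *
        ∏ w : {w : InfinitePlace L // IsComplex w}, (Equiv.Perm.sign (ρ w) : ℂ)) *
      ((K * (archERho S c *
          ∏ w : {w : InfinitePlace L // IsComplex w}, (if w ∈ S then Complex.exp (((2 * k w + 1 : ℤ) : ℂ) * ((c w 2 : ℂ) * I))
            else (((Circle.exp (c w 0) : ℂ) * Circle.exp (c w 2)) ^ (k w)) * (Circle.exp (c w 2) : ℂ)))) *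
        (archERhoG S (slotPerm ρ c) * F S (slotPerm ρ c))))
    (n : ℕ) (d : Fin n → {w : InfinitePlace L // IsComplex w} → Fin 3 → ℝ) :
    iteratedFDeriv ℝ n Φ x d = ∑ ρ ∈ partnerPerms S,
      (((∏ w : {w : InfinitePlace L // IsComplex w},
          ((SignType.sign ((w.1.embedding (α (lineOf (formSign L α w) ((ρ w).symm 1)))).re) : ℤ) * archMajoritySign L (Matrix.diagonal α) w) : ℤ) : ℂ) *
        ∏ w : {w : InfinitePlace L // IsComplex w}, (Equiv.Perm.sign (ρ w) : ℂ)) *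
      ∑ s : Finset (Fin n),
        iteratedFDeriv ℝ s.card (fun c : {w : InfinitePlace L // IsComplex w} → Fin 3 → ℝ => K * (archERho S c *
          ∏ w : {w : InfinitePlace L // IsComplex w}, (if w ∈ S then Complex.exp (((2 * k w + 1 : ℤ) : ℂ) * ((c w 2 : ℂ) * I))
            else (((Circle.exp (c w 0) : ℂ) * Circle.exp (c w 2)) ^ (k w)) * (Circle.exp (c w 2) : ℂ)))) x (d ∘ ⇑(s.orderEmbOfFin rfl)) *
        iteratedFDeriv ℝ sᶜ.card (fun c => archERhoG S (slotPerm ρ c) * F S (slotPerm ρ c)) x (d ∘ ⇑(sᶜ.orderEmbOfFin rfl)) := by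
  rw [(Filter.EventuallyEq.iteratedFDeriv ℝ hΦ n).self_of_nhds]
  have hW : ContDiff ℝ ∞ (fun c : {w : InfinitePlace L // IsComplex w} → Fin 3 → ℝ => K * (archERho S c *
      ∏ w : {w : InfinitePlace L // IsComplex w}, (if w ∈ S then Complex.exp (((2 * k w + 1 : ℤ) : ℂ) * ((c w 2 : ℂ) * I))
        else (((Circle.exp (c w 0) : ℂ) * Circle.exp (c w 2)) ^ (k w)) * (Circle.exp (c w 2) : ℂ)))) := contDiff_const_mul_archERho_mul_unit S k K
  have hO : ∀ ρ : {w : InfinitePlace L // IsComplex w} → Perm (Fin 3), IsOpen (slotPerm ρ ⁻¹' InRegG (slotSign L α) S) :=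
    fun ρ => (isOpen_inRegG _ S).preimage (continuous_slotPerm ρ)
  have hG : ∀ ρ ∈ partnerPerms S, ContDiffAt ℝ ∞ (fun c => archERhoG S (slotPerm ρ c) * F S (slotPerm ρ c)) x :=
    fun ρ hρ => (contDiffOn_twisted_slotPerm L α hI1 ρ x (htame ρ hρ)).contDiffAt ((hO ρ).mem_nhds (htame ρ hρ))
  have hterm : ∀ ρ ∈ partnerPerms S, ContDiffAt ℝ n (fun c => (((∏ w : {w : InfinitePlace L // IsComplex w},
          ((SignType.sign ((w.1.embedding (α (lineOf (formSign L α w) ((ρ w).symm 1)))).re) : ℤ) * archMajoritySign L (Matrix.diagonal α) w) : ℤ) : ℂ) *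
        ∏ w : {w : InfinitePlace L // IsComplex w}, (Equiv.Perm.sign (ρ w) : ℂ)) *
      ((K * (archERho S c *
          ∏ w : {w : InfinitePlace L // IsComplex w}, (if w ∈ S then Complex.exp (((2 * k w + 1 : ℤ) : ℂ) * ((c w 2 : ℂ) * I))
            else (((Circle.exp (c w 0) : ℂ) * Circle.exp (c w 2)) ^ (k w)) * (Circle.exp (c w 2) : ℂ)))) *
        (archERhoG S (slotPerm ρ c) * F S (slotPerm ρ c)))) x :=
    fun ρ hρ => (contDiffAt_const.mul (hW.contDiffAt.mul (hG ρ hρ))).of_le (by exact_mod_cast le_top)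
  rw [iteratedFDeriv_fun_sum_apply hterm, _root_.sum_apply]
  refine Finset.sum_congr rfl fun ρ hρ => ?_
  have hprod : ContDiffAt ℝ n (fun c => (K * (archERho S c *
          ∏ w : {w : InfinitePlace L // IsComplex w}, (if w ∈ S then Complex.exp (((2 * k w + 1 : ℤ) : ℂ) * ((c w 2 : ℂ) * I))
            else (((Circle.exp (c w 0) : ℂ) * Circle.exp (c w 2)) ^ (k w)) * (Circle.exp (c w 2) : ℂ)))) *
        (archERhoG S (slotPerm ρ c) * F S (slotPerm ρ c))) x := (hW.contDiffAt.mul (hG ρ hρ)).of_le (by exact_mod_cast le_top)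
  have hsm : (fun c => (((∏ w : {w : InfinitePlace L // IsComplex w},
          ((SignType.sign ((w.1.embedding (α (lineOf (formSign L α w) ((ρ w).symm 1)))).re) : ℤ) * archMajoritySign L (Matrix.diagonal α) w) : ℤ) : ℂ) *
        ∏ w : {w : InfinitePlace L // IsComplex w}, (Equiv.Perm.sign (ρ w) : ℂ)) *
      ((K * (archERho S c *
          ∏ w : {w : InfinitePlace L // IsComplex w}, (if w ∈ S then Complex.exp (((2 * k w + 1 : ℤ) : ℂ) * ((c w 2 : ℂ) * I))
            else (((Circle.exp (c w 0) : ℂ) * Circle.exp (c w 2)) ^ (k w)) * (Circle.exp (c w 2) : ℂ)))) *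
        (archERhoG S (slotPerm ρ c) * F S (slotPerm ρ c)))) = fun c => (((∏ w : {w : InfinitePlace L // IsComplex w},
          ((SignType.sign ((w.1.embedding (α (lineOf (formSign L α w) ((ρ w).symm 1)))).re) : ℤ) * archMajoritySign L (Matrix.diagonal α) w) : ℤ) : ℂ) *
        ∏ w : {w : InfinitePlace L // IsComplex w}, (Equiv.Perm.sign (ρ w) : ℂ)) •
      ((K * (archERho S c *
          ∏ w : {w : InfinitePlace L // IsComplex w}, (if w ∈ S then Complex.exp (((2 * k w + 1 : ℤ) : ℂ) * ((c w 2 : ℂ) * I))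
            else (((Circle.exp (c w 0) : ℂ) * Circle.exp (c w 2)) ^ (k w)) * (Circle.exp (c w 2) : ℂ)))) *
        (archERhoG S (slotPerm ρ c) * F S (slotPerm ρ c))) := rfl
  rw [hsm, iteratedFDeriv_const_smul_apply' (a := (((∏ w : {w : InfinitePlace L // IsComplex w},
          ((SignType.sign ((w.1.embedding (α (lineOf (formSign L α w) ((ρ w).symm 1)))).re) : ℤ) * archMajoritySign L (Matrix.diagonal α) w) : ℤ) : ℂ) *
        ∏ w : {w : InfinitePlace L // IsComplex w}, (Equiv.Perm.sign (ρ w) : ℂ))) hprod, _root_.smul_apply, smul_eq_mul]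
  congr 1
  exact iteratedFDeriv_mul_apply_eq_sum_powerset (hO ρ) n (hW.contDiffOn.of_le (by exact_mod_cast le_top))
    ((contDiffOn_twisted_slotPerm L α hI1 ρ).of_le (by exact_mod_cast le_top)) (htame ρ hρ) d

end Local

end Literature.NumberTheory.Rogawski1990

end
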